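import Summits.QuantumAdvantage.QuantumAdvantage.Theorems.WalkFiniteStateRungContraction

/-!
# Rung (G) `Coset21.TwoStepFiniteStateWalkHard 5` — part 2/6 — §3 `stub_equidist` (binomial equidistribution mod `M`, Doeblin)

VERBATIM split (for the 400-line rule) of planner qa-qnc0-p2 g22's `HOME/qa-qnc0-p2/line22/RungGCore.lean` v3 (sha16 `70defc48ef50f6ad`;
authored AND proved by the planner seat; landed by qn-prover-3 g14, ask P2-22d, `--supports stmt-QuantumAdvantage-28072`).
(+ one-line docstrings on undocumented auxiliaries, lint.)  See `WalkFiniteStateRungContraction.lean` for the planner's docstring.  WHAT THIS IS NOT: nothing about polynomial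
strategies or `LinSel`; separation NOT moved.
-/

noncomputable section

namespace Summit.QuantumAdvantage.AdviceFreeQNC0

namespace Coset21

namespace RungG

open Finset

variable {M : ℕ}

/-! ## §3 Lemma 1: binomial equidistribution mod `M` (Doeblin, explicit rate) -/

/-! ### The counts and their recursion -/

/-- `N_m(a) = #{v ∈ {0,1}^m : wt v ≡ a (mod M)}`. -/
def cnt (M m : ℕ) (a : ZMod M) : ℕ :=
  ((univ : Finset (Fin m → Bool)).filter fun v => ((wt v : ℕ) : ZMod M) = a).card

/-- Auxiliary step `cnt_zero` of rung (G) (planner qa-qnc0-p2, `RungGCore.lean` v3, verbatim). -/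
theorem cnt_zero (M : ℕ) (a : ZMod M) : cnt M 0 a = if (0 : ZMod M) = a then 1 else 0 := by
  unfold cnt
  rw [Finset.card_filter, Fintype.sum_unique]
  simp [wt]

/-- Auxiliary step `cnt_succ` of rung (G) (planner qa-qnc0-p2, `RungGCore.lean` v3, verbatim). -/
theorem cnt_succ (M m : ℕ) (a : ZMod M) : cnt M (m + 1) a = cnt M m a + cnt M m (a - 1) := by
  unfold cnt
  rw [Finset.card_filter, Finset.card_filter, Finset.card_filter]
  rw [← Fintype.sum_equiv (Fin.consEquiv fun _ => Bool)
    (fun q => if (((wt (Fin.cons q.1 q.2 : Fin (m + 1) → Bool) : ℕ) : ZMod M)) = a then 1 else 0)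
    (fun v => if ((wt v : ℕ) : ZMod M) = a then 1 else 0) (fun q => rfl)]
  rw [Fintype.sum_prod_type, Fintype.sum_bool]
  simp only [wt_cons, Bool.toNat_true, Bool.toNat_false, zero_add, Nat.cast_add, Nat.cast_one]
  rw [add_comm]
  congr 1
  refine Finset.sum_congr rfl fun u _ => ?_
  have h : ((1 : ZMod M) + ((wt u : ℕ) : ZMod M) = a) ↔ (((wt u : ℕ) : ZMod M) = a - 1) := by
    constructor
    · intro h; rw [← h]; ring
    · intro h; rw [h]; ring
  simp only [h]

/-- Auxiliary step `sum_cnt` of rung (G) (planner qa-qnc0-p2, `RungGCore.lean` v3, verbatim). -/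
theorem sum_cnt (M m : ℕ) [NeZero M] : ∑ a : ZMod M, cnt M m a = 2 ^ m := by
  unfold cnt
  rw [← Finset.card_eq_sum_card_fiberwise (fun v _ => Finset.mem_univ (((wt v : ℕ) : ZMod M)))]
  simp

/-! ### The error and the step operator -/

/-- `e_m(a) = N_m(a) − 2^m / M`. -/
def err (M m : ℕ) (a : ZMod M) : ℝ := (cnt M m a : ℝ) - (2 : ℝ) ^ m / M

/-- `T f (a) = f a + f (a − 1)`. -/
def stepT {M : ℕ} (f : ZMod M → ℝ) : ZMod M → ℝ := fun a => f a + f (a - 1)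

/-- Auxiliary step `stepT_apply` of rung (G) (planner qa-qnc0-p2, `RungGCore.lean` v3, verbatim). -/
theorem stepT_apply {M : ℕ} (f : ZMod M → ℝ) (a : ZMod M) : stepT f a = f a + f (a - 1) := rfl

/-- Auxiliary step `err_succ` of rung (G) (planner qa-qnc0-p2, `RungGCore.lean` v3, verbatim). -/
theorem err_succ (M m : ℕ) : err M (m + 1) = stepT (err M m) := by
  funext a
  simp only [err, stepT, cnt_succ, Nat.cast_add, pow_succ]
  ring

/-- Auxiliary step `err_add` of rung (G) (planner qa-qnc0-p2, `RungGCore.lean` v3, verbatim). -/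
theorem err_add (M m k : ℕ) : err M (m + k) = stepT^[k] (err M m) := by
  induction k with
  | zero => simp
  | succ k ih => rw [← add_assoc, err_succ, ih, ← Function.iterate_succ_apply' stepT k]

/-- Auxiliary step `sum_err` of rung (G) (planner qa-qnc0-p2, `RungGCore.lean` v3, verbatim). -/
theorem sum_err (M m : ℕ) [NeZero M] : ∑ a : ZMod M, err M m a = 0 := by
  unfold err
  rw [Finset.sum_sub_distrib, Finset.sum_const, Finset.card_univ, ZMod.card, nsmul_eq_mul]
  have h := sum_cnt M m
  have h' : ∑ a : ZMod M, (cnt M m a : ℝ) = (2 : ℝ) ^ m := by exact_mod_cast h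
  rw [h']
  have hM : (M : ℝ) ≠ 0 := by exact_mod_cast (NeZero.ne M)
  field_simp
  ring

/-- Auxiliary step `abs_err_zero` of rung (G) (planner qa-qnc0-p2, `RungGCore.lean` v3, verbatim). -/
theorem abs_err_zero (M : ℕ) (hM : 2 ≤ M) (a : ZMod M) : |err M 0 a| ≤ 1 - 1 / M := by
  have hMR : (2 : ℝ) ≤ M := by exact_mod_cast hM
  have hM0 : (0 : ℝ) < M := by linarith
  unfold err
  rw [cnt_zero]
  split_ifs with h
  · simp only [Nat.cast_one, pow_zero]
    rw [abs_of_nonneg]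
    · rw [sub_nonneg, div_le_one hM0]; linarith
  · simp only [Nat.cast_zero, pow_zero, zero_sub, abs_neg]
    rw [abs_of_pos (by positivity)]
    rw [div_le_iff₀ hM0, sub_mul, div_mul_cancel₀ _ hM0.ne', one_mul]
    linarith

/-! ### The operator `T`: one step at most doubles, `M` steps contract on mean-zero vectors -/

/-- Auxiliary step `abs_stepT_le` of rung (G) (planner qa-qnc0-p2, `RungGCore.lean` v3, verbatim). -/
theorem abs_stepT_le {M : ℕ} (f : ZMod M → ℝ) (C : ℝ) (h : ∀ a, |f a| ≤ C) (a : ZMod M) :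
    |stepT f a| ≤ 2 * C := by
  unfold stepT
  calc |f a + f (a - 1)| ≤ |f a| + |f (a - 1)| := abs_add_le _ _
    _ ≤ C + C := add_le_add (h a) (h (a - 1))
    _ = 2 * C := by ring

/-- Auxiliary step `abs_iterate_stepT_le` of rung (G) (planner qa-qnc0-p2, `RungGCore.lean` v3, verbatim). -/
theorem abs_iterate_stepT_le {M : ℕ} (k : ℕ) :
    ∀ (f : ZMod M → ℝ) (C : ℝ), (∀ a, |f a| ≤ C) → ∀ a, |(stepT^[k] f) a| ≤ 2 ^ k * C := by
  induction k with
  | zero => intro f C h a; simpa using h a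
  | succ k ih =>
    intro f C h a
    rw [Function.iterate_succ_apply']
    have := abs_stepT_le (stepT^[k] f) (2 ^ k * C) (ih f C h) a
    calc |stepT (stepT^[k] f) a| ≤ 2 * (2 ^ k * C) := this
      _ = 2 ^ (k + 1) * C := by ring

/-- Auxiliary step `iterate_stepT_nonneg` of rung (G) (planner qa-qnc0-p2, `RungGCore.lean` v3, verbatim). -/
theorem iterate_stepT_nonneg {M : ℕ} (k : ℕ) :
    ∀ f : ZMod M → ℝ, (∀ a, 0 ≤ f a) → ∀ a, 0 ≤ (stepT^[k] f) a := by
  induction k with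
  | zero => intro f h a; simpa using h a
  | succ k ih =>
    intro f h a
    rw [Function.iterate_succ_apply', stepT_apply]
    exact add_nonneg (ih f h a) (ih f h (a - 1))

/-- Positivity: after `k` steps, residue `a` has received (at least once) every `g (a − j)`, `j ≤ k`. -/
theorem sum_range_le_iterate_stepT {M : ℕ} (k : ℕ) :
    ∀ f : ZMod M → ℝ, (∀ a, 0 ≤ f a) → ∀ a, ∑ j ∈ range (k + 1), f (a - j) ≤ (stepT^[k] f) a := by
  induction k with
  | zero => intro f _ a; simp
  | succ k ih =>
    intro f h a
    rw [Function.iterate_succ_apply', Finset.sum_range_succ, stepT_apply]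
    have h1 := ih f h a
    have h2 := ih f h (a - 1)
    have h3 : f (a - 1 - k) ≤ ∑ j ∈ range (k + 1), f (a - 1 - j) :=
      Finset.single_le_sum (f := fun j : ℕ => f (a - 1 - j)) (fun j _ => h _) (Finset.mem_range.mpr (Nat.lt_succ_self k))
    have h4 : f (a - ((k + 1 : ℕ) : ZMod M)) = f (a - 1 - k) := by push_cast; ring_nf
    linarith

/-- Linearity: `T^k (C − f) = 2^k C − T^k f`. -/
theorem iterate_stepT_const_sub {M : ℕ} (k : ℕ) :
    ∀ (f : ZMod M → ℝ) (C : ℝ) (a : ZMod M), (stepT^[k] fun b => C - f b) a = 2 ^ k * C - (stepT^[k] f) a := by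
  induction k with
  | zero => intro f C a; simp
  | succ k ih =>
    intro f C a
    rw [Function.iterate_succ_apply, Function.iterate_succ_apply]
    have hstep : (stepT fun b => C - f b) = fun b => 2 * C - stepT f b := by
      funext b; simp only [stepT]; ring
    rw [hstep, ih (stepT f) (2 * C) a]
    ring

/-- Reindexing a full period of shifts. -/
theorem sum_range_shift_eq (k : ℕ) (g : ZMod (k + 1) → ℝ) (a : ZMod (k + 1)) :
    ∑ j ∈ range (k + 1), g (a - j) = ∑ x : ZMod (k + 1), g x := by
  rw [← Fin.sum_univ_eq_sum_range (fun j => g (a - j)) (k + 1)]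
  have h1 : ∑ i : Fin (k + 1), g (a - ((i : ℕ) : ZMod (k + 1))) = ∑ i : ZMod (k + 1), g (a - i) := by
    refine Finset.sum_congr rfl fun i _ => ?_
    have hi : ((i : ℕ) : ZMod (k + 1)) = (i : ZMod (k + 1)) := ZMod.natCast_zmod_val (n := k + 1) i
    rw [hi]
  rw [h1]
  exact Equiv.sum_comp (Equiv.subLeft a) g

/-- ONE-SIDED `M`-step bound: `Σ f = 0`, `f ≤ C` pointwise ⇒ `T^M f ≤ (2^M − 2M) C` (`M = k+1 ≥ 2`). -/
theorem iterate_stepT_le (k : ℕ) (_hk : 1 ≤ k) (f : ZMod (k + 1) → ℝ) (C : ℝ)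
    (hsum : ∑ a, f a = 0) (hle : ∀ a, f a ≤ C) (a : ZMod (k + 1)) :
    (stepT^[k + 1] f) a ≤ ((2 : ℝ) ^ (k + 1) - 2 * (k + 1)) * C := by
  set g : ZMod (k + 1) → ℝ := fun b => C - f b with hg
  have hg0 : ∀ b, 0 ≤ g b := fun b => by simp only [hg]; linarith [hle b]
  have hgsum : ∑ b, g b = (k + 1) * C := by
    simp only [hg, Finset.sum_sub_distrib, Finset.sum_const, Finset.card_univ, ZMod.card, nsmul_eq_mul, hsum]
    push_cast; ring
  have hf : f = fun b => C - g b := by funext b; simp [hg]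
  have hlin := iterate_stepT_const_sub (k + 1) g C a
  rw [← hf] at hlin
  -- lower bound `T^{k+1} g a ≥ 2 (k+1) C`
  have hlow : 2 * ((k + 1) * C) ≤ (stepT^[k + 1] g) a := by
    rw [Function.iterate_succ_apply', stepT_apply]
    have h1 := sum_range_le_iterate_stepT k g hg0 a
    have h2 := sum_range_le_iterate_stepT k g hg0 (a - 1)
    rw [sum_range_shift_eq k g a, hgsum] at h1
    rw [sum_range_shift_eq k g (a - 1), hgsum] at h2
    linarith
  rw [hlin]
  nlinarith

/-- TWO-SIDED `M`-step sup-norm contraction on mean-zero vectors. -/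
theorem abs_iterate_stepT_le_contract (k : ℕ) (hk : 1 ≤ k) (f : ZMod (k + 1) → ℝ) (C : ℝ)
    (hsum : ∑ a, f a = 0) (habs : ∀ a, |f a| ≤ C) (a : ZMod (k + 1)) :
    |(stepT^[k + 1] f) a| ≤ ((2 : ℝ) ^ (k + 1) - 2 * (k + 1)) * C := by
  rw [abs_le]
  constructor
  · -- apply the one-sided bound to `-f`
    have hnsum : ∑ a, (fun b => -f b) a = 0 := by simp [Finset.sum_neg_distrib, hsum]
    have hnle : ∀ a, (fun b => -f b) a ≤ C := fun a => by
      have := habs a; rw [abs_le] at this; simp only; linarith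
    have h := iterate_stepT_le k hk (fun b => -f b) C hnsum hnle a
    have hneg : (stepT^[k + 1] fun b => -f b) a = -(stepT^[k + 1] f) a := by
      have := iterate_stepT_const_sub (k + 1) f 0 a
      simp only [zero_sub, mul_zero] at this
      exact this
    linarith
  · exact iterate_stepT_le k hk f C hsum (fun a => (abs_le.mp (habs a)).2) a

/-! ### Assembly of the geometric bound -/

/-- Auxiliary step `abs_err_le_pow` of rung (G) (planner qa-qnc0-p2, `RungGCore.lean` v3, verbatim). -/
theorem abs_err_le_pow (k : ℕ) (hk : 1 ≤ k) (s : ℕ) (a : ZMod (k + 1)) :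
    |err (k + 1) s a| ≤ (2 : ℝ) ^ s * (1 - 1 / (k + 1 : ℝ)) := by
  have h := abs_iterate_stepT_le s (err (k + 1) 0) (1 - 1 / (k + 1 : ℝ))
    (fun b => by have := abs_err_zero (k + 1) (by omega) b; push_cast at this; exact this) a
  rw [← err_add, zero_add] at h
  exact h

/-- Auxiliary step `abs_err_le_block` of rung (G) (planner qa-qnc0-p2, `RungGCore.lean` v3, verbatim). -/
theorem abs_err_le_block (k : ℕ) (hk : 1 ≤ k) (s : ℕ) :
    ∀ (q : ℕ) (a : ZMod (k + 1)), |err (k + 1) ((k + 1) * q + s) a| ≤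
      (2 : ℝ) ^ ((k + 1) * q + s) * (((2 : ℝ) ^ (k + 1) - 2 * (k + 1)) / (2 : ℝ) ^ (k + 1)) ^ q
        * (1 - 1 / (k + 1 : ℝ)) := by
  intro q
  induction q with
  | zero => intro a; simpa using abs_err_le_pow k hk s a
  | succ q ih =>
    intro a
    have hidx : (k + 1) * (q + 1) + s = ((k + 1) * q + s) + (k + 1) := by ring
    rw [hidx, err_add]
    have h := abs_iterate_stepT_le_contract k hk (err (k + 1) ((k + 1) * q + s)) _
      (sum_err (k + 1) _) ih a
    refine h.trans (le_of_eq ?_)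
    have h2 : (2 : ℝ) ^ (k + 1) ≠ 0 := by positivity
    rw [pow_succ (((2 : ℝ) ^ (k + 1) - 2 * (k + 1)) / (2 : ℝ) ^ (k + 1)) q, pow_add (2 : ℝ) ((k + 1) * q + s) (k + 1)]
    field_simp

/-! ### Elementary numerics -/

/-- Auxiliary step `two_mul_le_two_pow` of rung (G) (planner qa-qnc0-p2, `RungGCore.lean` v3, verbatim). -/
theorem two_mul_le_two_pow (M : ℕ) : 2 * M ≤ 2 ^ M := by
  induction M with
  | zero => simp
  | succ n ih =>
    rcases Nat.eq_zero_or_pos n with h | h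
    · subst h; simp
    · calc 2 * (n + 1) = 2 * n + 2 := by ring
        _ ≤ 2 ^ n + 2 ^ n := by
          have : 2 ≤ 2 ^ n := by
            calc 2 = 2 ^ 1 := by norm_num
              _ ≤ 2 ^ n := Nat.pow_le_pow_right (by norm_num) h
          omega
        _ = 2 ^ (n + 1) := by ring

/-- Auxiliary step `sq_le_two_pow_succ` of rung (G) (planner qa-qnc0-p2, `RungGCore.lean` v3, verbatim). -/
theorem sq_le_two_pow_succ (M : ℕ) : M * M ≤ 2 ^ (M + 1) := by
  induction M with
  | zero => simp
  | succ n ih =>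
    rcases Nat.lt_or_ge n 3 with h | h
    · interval_cases n <;> norm_num
    · -- (n+1)² = n² + 2n + 1 ≤ 2 n² ≤ 2^(n+2)
      have h1 : (n + 1) * (n + 1) ≤ 2 * (n * n) := by nlinarith
      calc (n + 1) * (n + 1) ≤ 2 * (n * n) := h1
        _ ≤ 2 * 2 ^ (n + 1) := by omega
        _ = 2 ^ (n + 1 + 1) := by ring

/-- **`stub_equidist` of the rung-(G) skeleton — PROVED**, with `ρ = 1 − 2^{-(M+1)}`. -/
theorem stub_equidist : Equidist := by
  intro M hM
  obtain ⟨k, rfl⟩ : ∃ k, M = k + 1 := ⟨M - 1, by omega⟩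
  have hk : 1 ≤ k := by omega
  set N : ℝ := (k : ℝ) + 1 with hN
  have hN2 : (2 : ℝ) ≤ N := by rw [hN]; exact_mod_cast (show 2 ≤ k + 1 by omega)
  have hN0 : (0 : ℝ) < N := by linarith
  set P : ℝ := (2 : ℝ) ^ (k + 1) with hP
  have hP0 : 0 < P := by positivity
  set ρ : ℝ := 1 - 1 / (2 * P) with hρ
  have hρ0 : 0 ≤ ρ := by
    rw [hρ, sub_nonneg, div_le_one (by positivity)]
    have : (1 : ℝ) ≤ P := one_le_pow₀ (by norm_num)
    linarith
  have hρ1 : ρ < 1 := by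
    have : 0 < 1 / (2 * P) := by positivity
    rw [hρ]; linarith
  have hρle1 : ρ ≤ 1 := hρ1.le
  -- the two Bernoulli consequences
  have hB1 : 1 - N / (2 * P) ≤ ρ ^ (k + 1) := by
    have h := one_add_mul_le_pow (a := -(1 / (2 * P))) (by
      have : 0 < 1 / (2 * P) := by positivity
      have : 1 / (2 * P) ≤ 1 := by rw [div_le_one (by positivity)]; nlinarith [one_le_pow₀ (M₀ := ℝ) (a := 2) (by norm_num) (n := k + 1)]
      linarith) (k + 1)
    have e : (1 : ℝ) + -(1 / (2 * P)) = ρ := by rw [hρ]; ring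
    rw [e] at h
    have e2 : (1 : ℝ) + ((k + 1 : ℕ) : ℝ) * -(1 / (2 * P)) = 1 - N / (2 * P) := by rw [hN]; push_cast; ring
    linarith [h, e2.symm.le, e2.le]
  have hB2 : 1 - 2 * N / (2 * P) ≤ ρ ^ (2 * (k + 1)) := by
    have h := one_add_mul_le_pow (a := -(1 / (2 * P))) (by
      have : 0 < 1 / (2 * P) := by positivity
      have : 1 / (2 * P) ≤ 1 := by rw [div_le_one (by positivity)]; nlinarith [one_le_pow₀ (M₀ := ℝ) (a := 2) (by norm_num) (n := k + 1)]
      linarith) (2 * (k + 1))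
    have e : (1 : ℝ) + -(1 / (2 * P)) = ρ := by rw [hρ]; ring
    rw [e] at h
    have e2 : (1 : ℝ) + ((2 * (k + 1) : ℕ) : ℝ) * -(1 / (2 * P)) = 1 - 2 * N / (2 * P) := by rw [hN]; push_cast; ring
    linarith [h, e2.symm.le, e2.le]
  -- `δ := (P − 2N)/P`, `c₀ := 1 − 1/N`
  set δ : ℝ := (P - 2 * N) / P with hδ
  have hδ0 : 0 ≤ δ := by
    rw [hδ]; apply div_nonneg _ hP0.le
    rw [hP, hN, sub_nonneg]; exact_mod_cast two_mul_le_two_pow (k + 1)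
  have hδρ : δ ≤ ρ ^ (2 * (k + 1)) := by
    refine le_trans ?_ hB2
    have e1 : δ = 1 - 2 * N / P := by rw [hδ]; field_simp
    have e2 : 2 * N / (2 * P) = N / P := by field_simp
    have e3 : N / P ≤ 2 * N / P := by rw [div_le_div_iff₀ hP0 hP0]; nlinarith
    rw [e1, e2]
    linarith
  have hc0 : 1 - 1 / N ≤ ρ ^ (k + 1) := by
    refine le_trans ?_ hB1
    -- `N/(2P) ≤ 1/N` iff `N² ≤ 2P`
    have hsq : N * N ≤ 2 * P := by
      rw [hN, hP]; exact_mod_cast (by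
        have := sq_le_two_pow_succ (k + 1)
        calc (k + 1) * (k + 1) ≤ 2 ^ (k + 1 + 1) := this
          _ = 2 * 2 ^ (k + 1) := by ring)
    rw [sub_le_sub_iff_left, div_le_div_iff₀ (by positivity) hN0]
    nlinarith
  have hc0nn : 0 ≤ 1 - 1 / N := by
    rw [sub_nonneg, div_le_one hN0]; linarith
  refine ⟨ρ, hρ0, hρ1, fun m a => ?_⟩
  -- decompose `m = N q + s`
  set q := m / (k + 1) with hq
  set s := m % (k + 1) with hs
  have hm : (k + 1) * q + s = m := Nat.div_add_mod m (k + 1)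
  have hsN : s < k + 1 := Nat.mod_lt _ (Nat.succ_pos k)
  have hblock := abs_err_le_block k hk s q a
  rw [hm] at hblock
  have hcast : ((k : ℝ) + 1) = N := by rw [hN]
  simp only [hcast] at hblock
  change |err (k + 1) m a| ≤ ρ ^ m * (2 : ℝ) ^ m
  refine hblock.trans ?_
  rw [← hP, ← hδ, mul_assoc, mul_comm ((2 : ℝ) ^ m)]
  apply mul_le_mul_of_nonneg_right _ (by positivity)
  -- `δ^q (1 − 1/N) ≤ ρ^m`
  rcases Nat.eq_zero_or_pos q with hq0 | hq0
  · rw [hq0, pow_zero, one_mul]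
    have hm' : m = s := by rw [← hm, hq0]; ring
    calc 1 - 1 / N ≤ ρ ^ (k + 1) := hc0
      _ ≤ ρ ^ m := pow_le_pow_of_le_one hρ0 hρle1 (by omega)
  · calc δ ^ q * (1 - 1 / N) ≤ δ ^ q * 1 :=
          mul_le_mul_of_nonneg_left (by rw [sub_le_self_iff]; positivity) (pow_nonneg hδ0 q)
      _ = δ ^ q := mul_one _
      _ ≤ (ρ ^ (2 * (k + 1))) ^ q := pow_le_pow_left₀ hδ0 hδρ q
      _ = ρ ^ (2 * (k + 1) * q) := (pow_mul ρ (2 * (k + 1)) q).symm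
      _ ≤ ρ ^ m := pow_le_pow_of_le_one hρ0 hρle1 (by
          have h1 : m < (k + 1) * q + (k + 1) := by omega
          have h2 : k + 1 ≤ (k + 1) * q := Nat.le_mul_of_pos_right _ hq0
          have e : 2 * (k + 1) * q = 2 * ((k + 1) * q) := by ring
          rw [e]; omega)


end RungG

end Coset21

end Summit.QuantumAdvantage.AdviceFreeQNC0
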